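import Mathlib
import Summits.ValiantsHypothesis.ValiantsHypothesis.Theses.BarrierLever
import Summits.ValiantsHypothesis.ValiantsHypothesis.Theorems.BarrierLeverPrincipalMinorLayoutsNonsingularSuffices
import Summits.ValiantsHypothesis.ValiantsHypothesis.Theorems.BarrierLeverTransversalSufficesForPrincipal
import Summits.ValiantsHypothesis.ValiantsHypothesis.Theorems.BarrierLeverResultantKernelSufficesForTransversal
import Summits.ValiantsHypothesis.ValiantsHypothesis.Theorems.BarrierLeverTransversalResultantKernelNonsingularTropical

/-!
# Route BarrierLever — the 𝒟-side chain to `PartitionMinorsHitByVP` (stmt-ValiantsHypothesis-19717)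
# composed: UT(μ) ⇒ CT ⇒ TT ⇒ TNS ⇒ `PartitionMinorsHitByVP`

The three arrows of the cell's (valiant-natproofs, rung V4) 𝒟-side chain are tree theorems:
* CT ⇒ TT: `ResultantKernel.resultantKernelSufficesForTransversal` (item 19180);
* TT ⇒ TNS: `TransversalDictionary.transversalSufficesForPrincipal` (item 19153, val-np-p1);
* TNS ⇒ `PartitionMinorsHitByVP`: `PrincipalMinorWitness.principalMinorLayoutsNonsingularSuffices`
  (item 19133);
and the tropical certificate `ResultantKernel.resultantKernel_layout_ne_zero_of_unique_assignment`
turns a unique-assignment certificate `(μ, wt, π₀)` for a layout into CT for that layout.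

This file only COMPOSES them, so that the open end of the chain is ONE citable implication:
* `partitionMinorsHitByVP_of_resultantKernel` : CT (stmt-19179, inlined) → `PartitionMinorsHitByVP`;
* `principalMinorLayoutsNonsingular_of_resultantKernel` : CT → TNS (stmt-19126) (CT → TT,
  stmt-19152, is the landed `transversalMinorLayoutsNonsingular_of_resultantKernel`);
* `partitionMinorsHitByVP_of_uniqueAssignmentCertificates` : UT(μ) for every layout (pure
  combinatorics: for all `h r u w` injective, SOME map `μ` of row literals to column literals with
  weights has a unique optimal assignment) → `PartitionMinorsHitByVP`.

WHAT THIS IS NOT: no new mathematics; CT / UT(μ) remain OPEN (numerically certified for h ≤ 5,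
HOME/prover/gen5/UT-MEMO-g5.md); nothing on FSV Question 6 / crux stmt-14610 or `VP` vs `VNP`.
-/

-- layout Summits/ValiantsHypothesis/ValiantsHypothesis forces the duplicated namespace component
set_option linter.dupNamespace false

open Finset

namespace Summit.ValiantsHypothesis.ValiantsHypothesis.Theorems.BarrierLever.ResultantKernel

/-- **CT ⇒ TNS** (`PrincipalMinorLayoutsNonsingular`, stmt-19126): compose CT ⇒ TT (item 19180)
with TT ⇒ TNS (item 19153). -/
theorem principalMinorLayoutsNonsingular_of_resultantKernel
    (hCT : ∀ (h r : ℕ) (u w : Fin r → Finset (Fin h)), Function.Injective u →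
      Function.Injective w → ∃ p q : Fin (h + h) → ℂ, (Matrix.of fun i j : Fin r =>
        ∏ a : Fin h, ∏ c : Fin h, (p (if a ∈ u i then Fin.castAdd h a else Fin.natAdd h a)
          - q (if c ∈ w j then Fin.natAdd h c else Fin.castAdd h c))).det ≠ 0) :
    Summit.ValiantsHypothesis.ValiantsHypothesis.Theses.BarrierLever.PrincipalMinorLayoutsNonsingular :=
  TransversalDictionary.transversalSufficesForPrincipal
    (transversalMinorLayoutsNonsingular_of_resultantKernel hCT)

/-- **CT ⇒ `PartitionMinorsHitByVP`** (stmt-19717): the whole 𝒟-side chain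
CT ⇒ TT ⇒ TNS ⇒ `PartitionMinorsHitByVP` (items 19180, 19153, 19133). -/
theorem partitionMinorsHitByVP_of_resultantKernel
    (hCT : ∀ (h r : ℕ) (u w : Fin r → Finset (Fin h)), Function.Injective u →
      Function.Injective w → ∃ p q : Fin (h + h) → ℂ, (Matrix.of fun i j : Fin r =>
        ∏ a : Fin h, ∏ c : Fin h, (p (if a ∈ u i then Fin.castAdd h a else Fin.natAdd h a)
          - q (if c ∈ w j then Fin.natAdd h c else Fin.castAdd h c))).det ≠ 0) :
    Summit.ValiantsHypothesis.ValiantsHypothesis.Theses.BarrierLever.PartitionMinorsHitByVP :=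
  PrincipalMinorWitness.partitionMinorsHitByVP_of_principalMinorLayoutsNonsingular
    (principalMinorLayoutsNonsingular_of_resultantKernel hCT)

/-- **UT(μ) ⇒ `PartitionMinorsHitByVP`.** If every transversal layout `(u, w)` admits a
unique-assignment certificate — a map `μ` from row literals `Fin (h+h)` to column literals
(`Option`-valued), weights `wt`, a cost table `ord` agreeing with
`ord i j = Σ_{a,c} [μ (ρ_{u_i} a) = some (τ_{w_j} c)] · wt (ρ_{u_i} a)`, and a bijection `π₀` that is
the UNIQUE minimiser of `σ ↦ Σ_j ord (σ j) j` — then Nisan's partition-matrix minors are hit by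
`SmallCircuits ℂ (h+h) 8` eventually (item 19717). Pure combinatorics in, barrier statement out. -/
theorem partitionMinorsHitByVP_of_uniqueAssignmentCertificates
    (hUT : ∀ (h r : ℕ) (u w : Fin r → Finset (Fin h)), Function.Injective u →
      Function.Injective w →
      ∃ (μ : Fin (h + h) → Option (Fin (h + h))) (wt : Fin (h + h) → ℕ)
        (ord : Fin r → Fin r → ℕ) (π₀ : Equiv.Perm (Fin r)),
        (∀ i j, ord i j = ∑ a : Fin h, ∑ c : Fin h,
          if μ (if a ∈ u i then Fin.castAdd h a else Fin.natAdd h a)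
              = some (if c ∈ w j then Fin.natAdd h c else Fin.castAdd h c)
          then wt (if a ∈ u i then Fin.castAdd h a else Fin.natAdd h a) else 0) ∧
        (∀ σ : Equiv.Perm (Fin r), σ ≠ π₀ → ∑ j, ord (π₀ j) j < ∑ j, ord (σ j) j)) :
    Summit.ValiantsHypothesis.ValiantsHypothesis.Theses.BarrierLever.PartitionMinorsHitByVP := by
  refine partitionMinorsHitByVP_of_resultantKernel fun h r u w hu hw => ?_
  obtain ⟨μ, wt, ord, π₀, hord, huniq⟩ := hUT h r u w hu hw
  exact resultantKernel_layout_ne_zero_of_unique_assignment h r u w μ wt ord hord π₀ huniq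

end Summit.ValiantsHypothesis.ValiantsHypothesis.Theorems.BarrierLever.ResultantKernel
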